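import Summits.ResolutionOfSingularities.ResolutionOfSingularities.Theorems.MarkedTransferCampaignW46MohWindowSurfaceCore
import Summits.ResolutionOfSingularities.ResolutionOfSingularities.Theorems.MarkedTransferCampaignW46MohWindowSurfaceTransform
import Mathlib.Algebra.CharP.Lemmas
import HarnessLib

/-!
# [OURS · L1 W4.6 rung (iii-2), HEAVY-ROOT SIDE] Surface Moh window — TOP-OF-WINDOW RIGIDITY, ring level: over a window
# point of residual order `2p − 1`, the point of the blow-up over a SIMPLE root is singular and carries NO window presentation
# (cell res-hironaka, LADDER-RESOLUTION rung L, D-0089; seat res-L1-s46-pv-5 gen 4; host MarkedTransfer,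
# `--supports stmt-ResolutionOfSingularities-16155 --as helper`; statement file `…CampaignW46MohWindowSurface.lean`, res-L1-type-o1)

HONEST FRAMING. Nothing here is a statement of H. Hironaka's manuscript [Hironaka2017] and nothing here asserts that any
statement of it holds. PURE COMMUTATIVE ALGEBRA over a regular local ring, in the frame of res-D-pv-050 AS res-L1-s46-pv-12's
`…MohWindowSurfaceCore.lean` (`core`: TAME roots make the residual order DROP) and its heavy-side sibling `core_le`.

THE POINT (the other end of the one-blow-up law `d′ ≤ (d − p) + μ`). Let `L = 𝒪_{Z′,ξ′}` be the local ring of the point of the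
blow-up of a window point `ξ` (`J_ξ = (z^p + f)`, residual order `d`) lying over a root of the residue binary form of
multiplicity `μ = 1` (a SIMPLE root): regular system of parameters `(x, ρ, z₁)`, transform `J′ = (z₁^p + x^{d−p} f̃)` with
`f̃ ≡ ρ · unit (mod x)`. If `d = 2p − 1` — the TOP of the window — then `x^{p−1} f̃` has order exactly `p`, so `ξ′ ∈ Sing(E′)`
(`J′ ⊆ 𝔪^p`), while the initial form of the generator, `Z₁^p + unit · X^{p−1} P + …`, contains the monomial `X^{p−1} P`, which
no `p`-th power of a linear form contains (Frobenius): hence `J′` has NO presentation `(z′^p + f″)` with `z′ ∈ 𝔪`,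
`f″ ∈ 𝔪^{d″}`, `d″ > p` — no window presentation at all (`span_window_ne_of_simple_root`). In the rung this is RIGIDITY AT THE
TOP OF THE WINDOW: a window point of residual order `2p − 1` whose residue form has a simple (prime) factor can NEVER be an
admitted centre of a run that stays in the surface-window regime — blowing it up produces a singular point outside the window
(scheme level in the companion `…MohWindowSurfaceFreeze.lean`). For `p = 2` (`d = 3` is the whole window) it says: only points
whose residue cubic is the cube of a rational linear form are ever blown up inside the regime; in particular every TAME state of
characteristic `2` is terminal for the regime (no admitted step keeps the window), an honest (VAC)-type remark on
`MohWindowSurfaceTame*` at `p = 2`. Tools: Zariski–Samuel VIII §1 / Matsumura 14.2, 16.2 (i) as in the tree (`RegularLocalOrder`,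
`RsopMonomialIdeals`, res-D-pv-008's `coeff_mem_of_eval_mem_pow_succ`). [ZariskiSamuel1960] [Matsumura1987] [HauserWagner2014]
AI-written; AI review is weaker than expert review. No `sorry`; axioms standard.
-/

noncomputable section

set_option linter.dupNamespace false -- mandated namespace of this single-conjunct summit

namespace Summit.ResolutionOfSingularities.ResolutionOfSingularities.Theorems.CampaignW46.MohWindowSurface

open IsLocalRing MvPolynomial
open Literature.AlgebraicGeometry.Resolution
open Summit.ResolutionOfSingularities.ResolutionOfSingularities.Theorems.CampaignW46.MohWindowSurfaceResidualOrder

universe u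

section Ring

variable {L : Type*} [CommRing L] [IsRegularLocalRing L]

/-! ## 1. Quasi-regularity: the mixed monomial `y^{k-1} z` of a degree-`k` form -/

/-- **The mixed monomial of a degree-`k` form** (`k ≥ 2`): if `c₀ x^k + c₁ y^k + c₂ z^k + c₃ y^{k−1} z ∈ 𝔪^{k+1}` for a regular
system of parameters `(x, y, z)`, then `c₃ ∈ 𝔪` (quasi-regularity, Matsumura 16.2 (i), through res-D-pv-008's
`coeff_mem_of_eval_mem_pow_succ`; the four monomials are distinct since `k ≥ 2`). [cite: Matsumura1987, Thm. 16.2 (i)] -/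
theorem coeff_mixed_mem_of_mem_pow_succ (h3 : (maximalIdeal L).spanFinrank = 3) {x y z : L}
    (hxyz : Ideal.span {x, y, z} = maximalIdeal L) {k : ℕ} (hk : 2 ≤ k) {c₀ c₁ c₂ c₃ : L}
    (h : c₀ * x ^ k + c₁ * y ^ k + c₂ * z ^ k + c₃ * (y ^ (k - 1) * z) ∈ maximalIdeal L ^ (k + 1)) :
    c₃ ∈ maximalIdeal L := by
  classical
  have hR : IsRegularLocalRing L := inferInstance
  set m₃ : Fin 3 →₀ ℕ := Finsupp.single 1 (k - 1) + Finsupp.single 2 1 with hm₃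
  have hdeg : ∀ i : Fin 3, (Finsupp.single i k).degree = k := fun i => by simp [Finsupp.degree_single]
  have hdeg₃ : m₃.degree = k := by
    rw [hm₃, map_add, Finsupp.degree_single, Finsupp.degree_single]; omega
  set F : MvPolynomial (Fin 3) L := monomial (Finsupp.single (0 : Fin 3) k) c₀ + monomial (Finsupp.single (1 : Fin 3) k) c₁ +
      monomial (Finsupp.single (2 : Fin 3) k) c₂ + monomial m₃ c₃ with hFdef
  have hF : F.IsHomogeneous k :=
    (((isHomogeneous_monomial _ (hdeg 0)).add (isHomogeneous_monomial _ (hdeg 1))).add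
      (isHomogeneous_monomial _ (hdeg 2))).add (isHomogeneous_monomial _ hdeg₃)
  have hmono : (monomial m₃ c₃ : MvPolynomial (Fin 3) L) = C c₃ * (X 1 ^ (k - 1) * X 2) := by
    rw [hm₃, X_pow_eq_monomial, X, monomial_mul, mul_one, C_mul_monomial, mul_one]
  have hev₃ : eval ![x, y, z] (monomial m₃ c₃) = c₃ * (y ^ (k - 1) * z) := by
    rw [hmono, map_mul, map_mul, map_pow, eval_C, eval_X, eval_X]
    rfl
  have hev : eval ![x, y, z] F = c₀ * x ^ k + c₁ * y ^ k + c₂ * z ^ k + c₃ * (y ^ (k - 1) * z) := by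
    rw [hFdef, map_add, map_add, map_add, eval_monomial_single, eval_monomial_single, eval_monomial_single, hev₃]
    rfl
  have key := coeff_mem_of_eval_mem_pow_succ hR h3 hxyz hF (by rw [hev]; exact h) m₃
  -- the coefficient of `F` at `m₃` is `c₃`
  have hne : ∀ i : Fin 3, Finsupp.single i k ≠ m₃ := by
    intro i heq
    have h2 := Finsupp.ext_iff.mp heq 2
    have h1 := Finsupp.ext_iff.mp heq 1
    simp only [hm₃, Finsupp.coe_add, Pi.add_apply, Finsupp.single_eq_same] at h1 h2
    fin_cases i <;> simp at h1 h2
    omega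
  have hcoeff : F.coeff m₃ = c₃ := by
    rw [hFdef, coeff_add, coeff_add, coeff_add, coeff_monomial, coeff_monomial, coeff_monomial, coeff_monomial,
      if_neg (hne 0), if_neg (hne 1), if_neg (hne 2), if_pos rfl]
    ring
  rwa [hcoeff] at key

/-! ## 2. No window presentation over a simple root at the top of the window -/

/-- **[OURS · L1 W4.6 rung (iii-2), heavy side] TOP-OF-WINDOW RIGIDITY, ring level.** Let `L` be a regular local ring of embedding
dimension `3` and characteristic `p`, with regular system of parameters `(x, ρ, z₁)`; let `f ≡ ρ · G (mod x)` with `G` a unit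
(the point lies over a SIMPLE root `ρ` of the residue form). Then the principal ideal `(z₁^p + x^{p−1} · f)` — the transform of a
window germ of residual order `d = 2p − 1` — is NOT of the form `(z′^p + f″)` with `z′ ∈ 𝔪`, `f″ ∈ 𝔪^{d″}`, `d″ > p`: it has no
window presentation (of either reading). Proof: a unit `u` with `u·(z₁^p + x^{p−1} f) = z′^p + f″`; writing
`z′ = αx + βρ + λz₁`, `λ` is a unit (read in `L/(x, ρ)`), so `(z′, x, ρ)` is a regular system of parameters, and Frobenius turns
the identity into a degree-`p` form in `(z′, x, ρ)` lying in `𝔪^{p+1}` whose coefficient at the mixed monomial `x^{p−1}ρ` is the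
unit `u λ^p G` — contradicting quasi-regularity. NOT a statement of the manuscript. [folklore] -/
theorem span_window_ne_of_simple_root (p : ℕ) [Fact p.Prime] [CharP L p] (h3 : (maximalIdeal L).spanFinrank = 3)
    {x ρ z₁ : L} (hgen : Ideal.span {x, ρ, z₁} = maximalIdeal L)
    {f G : L} (hG : IsUnit G) (hf : f - ρ * G ∈ Ideal.span {x})
    {z' f'' : L} {d'' : ℕ} (hz' : z' ∈ maximalIdeal L) (hf'' : f'' ∈ maximalIdeal L ^ d'') (hpd : p < d'') :
    Ideal.span {z₁ ^ p + x ^ (p - 1) * f} ≠ Ideal.span {z' ^ p + f''} := by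
  classical
  intro heq
  haveI := isDomain_of_isRegularLocalRing (R := L)
  have hp2 : 2 ≤ p := (Fact.out : p.Prime).two_le
  set g : L := z₁ ^ p + x ^ (p - 1) * f with hg
  -- (1) the two generators differ by a unit
  obtain ⟨u, hu⟩ := Ideal.span_singleton_eq_span_singleton.mp heq
  have hx𝔪 : x ∈ maximalIdeal L := hgen ▸ Ideal.subset_span (by simp)
  have hρ𝔪 : ρ ∈ maximalIdeal L := hgen ▸ Ideal.subset_span (by simp)
  have hz𝔪 : z₁ ∈ maximalIdeal L := hgen ▸ Ideal.subset_span (by simp)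
  -- (2) expand `z'` in the parameters
  have hz'mem : z' ∈ Ideal.span ({x, ρ, z₁} : Set L) := hgen ▸ hz'
  obtain ⟨α, r, hr, hz'eq⟩ := Ideal.mem_span_insert.mp hz'mem
  obtain ⟨β, lam, rfl⟩ := Ideal.mem_span_pair.mp hr
  -- (3) `lam` is a unit: read in `L/(x, ρ)`
  have hlam : IsUnit lam := by
    by_contra hlam
    have hlam𝔪 : lam ∈ maximalIdeal L := (mem_maximalIdeal _).mpr (mem_nonunits_iff.mpr hlam)
    obtain ⟨hreg, hz2⟩ := quotient_pair h3 hgen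
    haveI := hreg
    have hle : Ideal.span {x, ρ} ≤ maximalIdeal L := by
      rw [Ideal.span_le]; intro a ha; rcases ha with rfl | rfl <;> simpa
    haveI := nontrivial_quotient_of_le hle
    set π := Ideal.Quotient.mk (Ideal.span ({x, ρ} : Set L)) with hπ
    have hπx : π x = 0 := Ideal.Quotient.eq_zero_iff_mem.mpr (Ideal.subset_span (by simp))
    have hπρ : π ρ = 0 := Ideal.Quotient.eq_zero_iff_mem.mpr (Ideal.subset_span (by simp))
    have hπg : π g = π z₁ ^ p := by
      rw [hg, map_add, map_pow, map_mul, map_pow, hπx, zero_pow (by omega), zero_mul, add_zero]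
    have hπz' : π z' = π lam * π z₁ := by
      rw [hz'eq, map_add, map_mul, map_add, map_mul, map_mul, hπx, hπρ, mul_zero, mul_zero, zero_add,
        zero_add]
    have h1 : π z' ∈ maximalIdeal _ ^ 2 := by
      rw [hπz', pow_two]
      exact Ideal.mul_mem_mul (mk_mem_maximalIdeal _ hlam𝔪) (mk_mem_maximalIdeal _ hz𝔪)
    have h2 : π (z' ^ p + f'') ∈ maximalIdeal _ ^ (p + 1) := by
      rw [map_add, map_pow]
      refine Ideal.add_mem _ ?_ ?_
      · have := Ideal.pow_mem_pow h1 p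
        rw [← pow_mul] at this
        exact Ideal.pow_le_pow_right (by omega) this
      · exact Ideal.pow_le_pow_right (by omega) (mk_mem_maximalIdeal_pow _ hf'')
    rw [← hu, map_mul, hπg, mul_comm] at h2
    exact unit_mul_pow_not_mem_pow_succ hz2 ((Units.isUnit u).map π) p h2
  -- (4) the new parameter system `(z', x, ρ)`
  obtain ⟨lam', hlam'⟩ := hlam.exists_left_inv
  have hz₁ : z₁ = lam' * (z' - α * x - β * ρ) := by
    have : z' - α * x - β * ρ = lam * z₁ := by rw [hz'eq]; ring
    rw [this, ← mul_assoc, hlam', one_mul]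
  have hgen' : Ideal.span {z', x, ρ} = maximalIdeal L := by
    rw [← hgen]
    have hx1 : x ∈ Ideal.span ({z', x, ρ} : Set L) := Ideal.subset_span (by simp)
    have hρ1 : ρ ∈ Ideal.span ({z', x, ρ} : Set L) := Ideal.subset_span (by simp)
    have hz'1 : z' ∈ Ideal.span ({z', x, ρ} : Set L) := Ideal.subset_span (by simp)
    have hx2 : x ∈ Ideal.span ({x, ρ, z₁} : Set L) := Ideal.subset_span (by simp)
    have hρ2 : ρ ∈ Ideal.span ({x, ρ, z₁} : Set L) := Ideal.subset_span (by simp)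
    apply le_antisymm
    · rw [Ideal.span_le]
      rintro c (rfl | rfl | rfl)
      · exact hz'mem
      · exact hx2
      · exact hρ2
    · rw [Ideal.span_le]
      rintro c (rfl | rfl | rfl)
      · exact hx1
      · exact hρ1
      · rw [SetLike.mem_coe, hz₁]
        exact Ideal.mul_mem_left _ _ (Ideal.sub_mem _ (Ideal.sub_mem _ hz'1 (Ideal.mul_mem_left _ _ hx1))
          (Ideal.mul_mem_left _ _ hρ1))
  -- Frobenius: `lam^p z₁^p = z'^p - α^p x^p - β^p ρ^p`
  have hfrob : lam ^ p * z₁ ^ p = z' ^ p - α ^ p * x ^ p - β ^ p * ρ ^ p := by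
    have : lam * z₁ = z' - α * x - β * ρ := by rw [hz'eq]; ring
    rw [← mul_pow, this, sub_pow_char, sub_pow_char, mul_pow, mul_pow]
  -- `f = ρ G + c x`
  obtain ⟨c, hc⟩ := Ideal.mem_span_singleton'.mp hf
  have hfeq : f = ρ * G + c * x := by rw [hc]; ring
  have hxp : x ^ p = x ^ (p - 1) * x := by rw [← pow_succ, Nat.sub_add_cancel (by omega)]
  -- (5) the degree-`p` form in `(z', x, ρ)` lying in `𝔪^{p+1}`
  have hkey : (↑u - lam ^ p) * z' ^ p + (↑u * lam ^ p * c - ↑u * α ^ p) * x ^ p + (-(↑u * β ^ p)) * ρ ^ p +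
      (↑u * lam ^ p * G) * (x ^ (p - 1) * ρ) = lam ^ p * f'' := by
    have h1 : lam ^ p * (g * ↑u) = lam ^ p * (z' ^ p + f'') := by rw [hu]
    have h2 : lam ^ p * (g * ↑u) = ↑u * (lam ^ p * z₁ ^ p) + ↑u * lam ^ p * (x ^ (p - 1) * f) := by rw [hg]; ring
    rw [h2, hfrob, hfeq] at h1
    linear_combination h1 + (↑u * lam ^ p * c) * hxp
  have hmem : (↑u - lam ^ p) * z' ^ p + (↑u * lam ^ p * c - ↑u * α ^ p) * x ^ p + (-(↑u * β ^ p)) * ρ ^ p +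
      (↑u * lam ^ p * G) * (x ^ (p - 1) * ρ) ∈ maximalIdeal L ^ (p + 1) := by
    rw [hkey]
    exact Ideal.mul_mem_left _ _ (Ideal.pow_le_pow_right (by omega) hf'')
  have hcoef := coeff_mixed_mem_of_mem_pow_succ h3 hgen' hp2 hmem
  have hunit : IsUnit (↑u * lam ^ p * G) := ((Units.isUnit u).mul (hlam.pow p)).mul hG
  exact (maximalIdeal.isMaximal L).ne_top (Ideal.eq_top_of_isUnit_mem _ hcoef hunit)

/-- **Singularity over a simple root at the top of the window**: with `(x, ρ, z₁)` a regular system of parameters and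
`f ≡ ρ G (mod x)`, the transform generator `z₁^p + x^{p−1} f` lies in `𝔪^p` — the point IS singular for `E′ = (J′, p)`.
[folklore] -/
theorem window_transform_mem_pow_of_simple_root (p : ℕ) (hp : 1 ≤ p) {x ρ z₁ : L} (hgen : Ideal.span {x, ρ, z₁} = maximalIdeal L)
    {f G : L} (hf : f - ρ * G ∈ Ideal.span {x}) :
    z₁ ^ p + x ^ (p - 1) * f ∈ maximalIdeal L ^ p := by
  have hx𝔪 : x ∈ maximalIdeal L := hgen ▸ Ideal.subset_span (by simp)
  have hρ𝔪 : ρ ∈ maximalIdeal L := hgen ▸ Ideal.subset_span (by simp)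
  have hz𝔪 : z₁ ∈ maximalIdeal L := hgen ▸ Ideal.subset_span (by simp)
  obtain ⟨c, hc⟩ := Ideal.mem_span_singleton'.mp hf
  have hfeq : f = ρ * G + c * x := by rw [hc]; ring
  have hf𝔪 : f ∈ maximalIdeal L := by
    rw [hfeq]; exact Ideal.add_mem _ (Ideal.mul_mem_right _ _ hρ𝔪) (Ideal.mul_mem_left _ _ hx𝔪)
  refine Ideal.add_mem _ (Ideal.pow_mem_pow hz𝔪 p) ?_
  have := Ideal.mul_mem_mul (Ideal.pow_mem_pow hx𝔪 (p - 1)) hf𝔪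
  rwa [← pow_succ, Nat.sub_add_cancel hp] at this

end Ring

end Summit.ResolutionOfSingularities.ResolutionOfSingularities.Theorems.CampaignW46.MohWindowSurface

end
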